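import Summits.Ventures.YMGap.RobustBall.StarDoorZd
import Summits.Ventures.YMGap.RobustBall.MassGapOnBall
import Summits.Ventures.YMGap.RobustBall.PerturbedCollar
import HarnessLib

/-!
# Venture YMGap, track ROBUST-BALL (Y2) — crux Y2-X2-Zd, step 1b: the radius-`D` star door for the
# PERTURBED `SU(N)` specifications on `ℤ^d` ⇒ `PerturbedMassGapAt`

HONEST FRAMING. WHAT THIS IS: a venture file (cell `pub-ymgap`, track Y2 ROBUST-BALL, seat ds-2).
The plug of the generic `ℤ^d` star door (`StarDoorZd.lean`) into the track's `ℤ^d` currency: for a link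
potential `W` on `ℤ^d` with continuous terms depending only on their own links, supported by `supp` with
`ℓ^∞` range `R`, the perturbed specification `perturbedYM (fundamentalRep (Fin N)) (N β) W supp` (rb-p1)
has star kernels quasilocal with radius `R + 2` (`perturbed_star_hloc`, from the tree's
`dependsOn_specAvg_perturbedYM_collar`); hence a star window bound `StarWindowBoundZdR` with any locality
radius `D ≥ R + 2` and received sum `ρ < 1` gives `PerturbedMassGapAt d N β W supp` — the unique DLR
state AND Shen–Zhu–Zhu exponential clustering of Lipschitz cylinder observables, rate
`starRate d ρ/(D+2)` per lattice unit, `c₁ = 4(2√N)² n² e^{starRate d ρ}`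
(`perturbedMassGapAt_of_starWindowBoundZdR`). Every step is in infinite volume; no torus limit is
taken. WHAT THIS IS NOT: no array is constructed here (that is the chart-transfer file); no number;
strong-coupling LATTICE bookkeeping — nothing about the continuum or the Millennium problem.

## References
* R. L. Dobrushin, S. B. Shlosman (1985), Thm. 1; H. Föllmer, LNM 1362 (1988) Ch. I Thm. (2.13);
  H. Shen, R. Zhu, X. Zhu, CMP 400 (2023), Cor. 1.6 (the clustering currency).
* The tree: `RobustBall/StarDoorZd.lean` (ds-2), `RobustBall/MassGapOfDoor.lean` (rb-p1: the currency
  conversion, followed line by line), `RobustBall/PerturbedCollar.lean` (quasilocality with the `W`-collar).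
-/

noncomputable section

open MeasureTheory ProbabilityTheory Function Finset Real
open scoped NNReal
open Literature.Probability.LatticeModels
open Literature.Probability.LatticeModels.DobrushinMetric (IsLipBound)
open Literature.MathematicalPhysics.QuantumLattice
open Literature.MathematicalPhysics.QuantumFieldTheory hiding ZdEdge
open Literature.MathematicalPhysics.QuantumFieldTheory.Balaban1983to89.StrongCouplingTorusWindow (specAvg)
open Summit.Ventures.YMGap.DSWindowZd

namespace Summit.Ventures.YMGap.RobustBall

variable {d N : ℕ}

/-! ### Coordinates from sup-norm bounds -/

/-- Coordinate bounds from a sup-norm bound: `‖a‖ ≤ n` gives `|a i| ≤ n` for every `i`. [folklore] -/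
theorem natAbs_le_of_norm_le {a : Site d} {n : ℕ} (h : ‖a‖ ≤ n) (i : Fin d) : (a i).natAbs ≤ n := by
  have h1 : ‖a i‖ ≤ n := (norm_le_pi_norm a i).trans h
  rw [Int.norm_eq_abs, ← Int.cast_abs, Int.abs_eq_natAbs] at h1
  exact_mod_cast h1

/-! ### Quasilocality of the perturbed star kernels with radius `R + 2` -/

/-- **The `W`-collar of a vertex star lies in the radius-`D` locality set** for every `D ≥ R + 2`, `R` the
`ℓ^∞` range of the support family: a star link is within `1` of the vertex, a plaquette neighbour within
`1` of it, a link of a listed set through it within `R`. [folklore] -/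
theorem star_collar_subset_starNbhdZdR {supp : Finset (ZdEdge d) → Finset (Finset (ZdEdge d))} {R D : ℕ}
    (hR : ∀ e, ∀ X ∈ supp {e}, e ∈ X → ∀ y ∈ X, ‖e.1 - y.1‖ ≤ (R : ℝ)) (hD : R + 2 ≤ D) (s : Site d) :
    vertexStarZd s ∪ (vertexStarZd s).biUnion (perturbedNbr supp) ⊆ starNbhdZdR D s := by
  classical
  intro y hy
  refine mem_starNbhdZdR.2 fun i => ?_
  rcases Finset.mem_union.1 hy with h | h
  · exact (natAbs_sub_le_one_of_mem_vertexStarZd h i).trans (by omega)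
  · obtain ⟨e, he, hye⟩ := Finset.mem_biUnion.1 h
    have h1 := natAbs_sub_le_one_of_mem_vertexStarZd he i
    have h2 : (y.1 i - e.1 i).natAbs ≤ R + 1 := by
      rcases (mem_perturbedNbr_iff.1 hye).2 with hy' | ⟨X, hX, heX, hyX⟩
      · have h3 : ‖y.1 - e.1‖ ≤ ((1 : ℕ) : ℝ) := by
          rw [norm_sub_rev]; exact_mod_cast norm_sub_le_one_of_mem_linkPlaqNbr hy'
        have := natAbs_le_of_norm_le h3 i
        simp only [Pi.sub_apply] at this
        omega
      · have h3 : ‖y.1 - e.1‖ ≤ (R : ℝ) := by rw [norm_sub_rev]; exact hR e X hX heX y hyX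
        have := natAbs_le_of_norm_le h3 i
        simp only [Pi.sub_apply] at this
        omega
    have : y.1 i - s i = (y.1 i - e.1 i) + (e.1 i - s i) := by ring
    rw [this]
    exact (Int.natAbs_add_le _ _).trans (by omega)

/-- **Quasilocality of the perturbed star kernels** (the hypothesis `hloc` of the `ℤ^d` star door): for a
link potential with measurable terms depending only on their own links, supported by `supp` with range `R`,
the star kernel `γ^W_⋆(· | ζ)` of `perturbedYM ρ β W supp` applied to a measurable star-local `f` depends
on `ζ` only through the links of `starNbhdZdR D s`, `D ≥ R + 2` (tree
`dependsOn_specAvg_perturbedYM_collar`). [folklore] -/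
theorem perturbed_star_hloc {G : Type*} [Group G] [TopologicalSpace G] [IsTopologicalGroup G]
    [CompactSpace G] [MeasurableSpace G] [BorelSpace G] [SecondCountableTopology G]
    (ρ : G →* Matrix (Fin N) (Fin N) ℂ) (hρ : Continuous ρ) (β : ℝ) {W : Potential (ZdEdge d) G}
    (hWm : ∀ X, Measurable (W X)) (hWdep : ∀ X, DependsOn (W X) (↑X : Set (ZdEdge d)))
    {supp : Finset (ZdEdge d) → Finset (Finset (ZdEdge d))} (hsupp : W.IsSupportedBy supp) {R D : ℕ}
    (hR : ∀ e, ∀ X ∈ supp {e}, e ∈ X → ∀ y ∈ X, ‖e.1 - y.1‖ ≤ (R : ℝ)) (hD : R + 2 ≤ D)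
    (c : ZdEdge d) (ζ ζ' : LGConfig d G) (hζ : ∀ v ∈ starNbhdZdR D c.1, ζ v = ζ' v)
    (f : LGConfig d G → ℝ) (hfm : Measurable f) (hfdep : DependsOn f (starWinZd c : Set (ZdEdge d))) :
    ∫ σ, f σ ∂(perturbedYM ρ β W supp (starWinZd c) ζ) =
      ∫ σ, f σ ∂(perturbedYM ρ β W supp (starWinZd c) ζ') := by
  have h := dependsOn_specAvg_perturbedYM_collar ρ hρ β hWm hWdep hsupp (starWinZd c) hfm hfdep
  exact h fun v hv => hζ v (star_collar_subset_starNbhdZdR hR hD c.1 (Finset.mem_coe.1 hv))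

/-! ### The door in the track's currency -/

/-- **THE RADIUS-`D` STAR DOOR ⇒ THE MEMBER'S MASS GAP ON `ℤ^d`.** For a link potential `W` on `ℤ^d` with
continuous terms depending only on their own links, supported by `supp` with `ℓ^∞` range `R`, a star
window bound for the perturbed `SU(N)` specification `perturbedYM (fundamentalRep (Fin N)) (N β) W supp`
with locality radius `D ≥ R + 2` and received sum `0 ≤ ρ < 1` (Frobenius weight) gives
`PerturbedMassGapAt d N β W supp`: the DLR state exists (`perturbedGibbsMeasures_nonempty`) and is unique
(`hasUniqueGibbsMeasure_of_starWindowBoundZdR`), and every DLR state clusters exponentially in the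
Shen–Zhu–Zhu form with rate `starRate d ρ/(D+2)` and `c₁ = 4(2√N)² n² e^{starRate d ρ}`
(`abs_covariance_le_of_starWindowBoundZdR`; Lipschitz cylinder observables are link-Lipschitz with
vector `K·1_Λ`, `IsLipschitzCylinder.isLipBound`). Infinite volume throughout. [folklore] -/
theorem perturbedMassGapAt_of_starWindowBoundZdR {β ρ : ℝ} {R D : ℕ}
    {W : Potential (ZdEdge d) (SUN N)} (hWc : ∀ X, Continuous (W X))
    (hWdep : ∀ X, DependsOn (W X) (↑X : Set (ZdEdge d)))
    {supp : Finset (ZdEdge d) → Finset (Finset (ZdEdge d))} (hsupp : W.IsSupportedBy supp)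
    (hR : ∀ e, ∀ X ∈ supp {e}, e ∈ X → ∀ y ∈ X, ‖e.1 - y.1‖ ≤ (R : ℝ)) (hD : R + 2 ≤ D)
    (hρ0 : 0 ≤ ρ) (hρ1 : ρ < 1)
    (h : StarWindowBoundZdR d N (perturbedYM (d := d) (fundamentalRep (Fin N)) (N * β) W supp) D ρ
      suFrobDist) :
    PerturbedMassGapAt d N β W supp := by
  classical
  haveI : SecondCountableTopology (Matrix (Fin N) (Fin N) ℂ) :=
    inferInstanceAs (SecondCountableTopology (Fin N → Fin N → ℂ))
  haveI : SecondCountableTopology (SUN N) := Topology.IsEmbedding.subtypeVal.secondCountableTopology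
  have hW : W.IsAdapted := fun X => ⟨hWdep X, (hWc X).measurable⟩
  have hWb : ∀ X, ∃ C, ∀ U, |W X U| ≤ C := fun X => exists_bound_of_continuous (hWc X)
  have hγ : IsSpecification (perturbedYM (d := d) (fundamentalRep (Fin N)) (N * β) W supp) :=
    isSpecification_perturbedYM _ (continuous_fundamentalRep (Fin N)) _ hW hWb hsupp
  have hne : (perturbedGibbsMeasures (d := d) (fundamentalRep (Fin N)) (N * β) W supp).Nonempty :=
    perturbedGibbsMeasures_nonempty _ (continuous_fundamentalRep (Fin N)) _ hWc hWdep hsupp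
  have hD1 : 1 ≤ D := by omega
  have hloc : ∀ (c : ZdEdge d) (ζ ζ' : LGConfig d (SUN N)), (∀ v ∈ starNbhdZdR D c.1, ζ v = ζ' v) →
      ∀ (f : LGConfig d (SUN N) → ℝ), Measurable f → (∃ B, ∀ σ, |f σ| ≤ B) →
        DependsOn f (starWinZd c : Set (ZdEdge d)) →
        ∫ σ, f σ ∂(perturbedYM (d := d) (fundamentalRep (Fin N)) (N * β) W supp (starWinZd c) ζ) =
          ∫ σ, f σ ∂(perturbedYM (d := d) (fundamentalRep (Fin N)) (N * β) W supp (starWinZd c) ζ') :=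
    fun c ζ ζ' hζ f hfm _ hfdep => perturbed_star_hloc _ (continuous_fundamentalRep (Fin N)) _
      (fun X => (hWc X).measurable) hWdep hsupp hR hD c ζ ζ' hζ f hfm hfdep
  refine ⟨hasUniqueGibbsMeasure_of_starWindowBoundZdR hγ hne hD1 hloc hρ0 hρ1 h, fun μ hμ => ?_⟩
  -- clustering of the DLR state `μ`
  set κ : ℝ := starRate d ρ with hκ
  have hκ0 : 0 < κ := starRate_pos hρ0 hρ1
  have hD2 : (0 : ℝ) < ((D + 2 : ℕ) : ℝ) := by positivity
  have hμ' : IsGibbsMeasure (perturbedYM (d := d) (fundamentalRep (Fin N)) (N * β) W supp) μ := hμ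
  haveI := hμ'.isProbabilityMeasure
  refine ⟨κ / (D + 2 : ℕ), div_pos hκ0 hD2, fun n =>
    ⟨4 * (2 * Real.sqrt N) ^ 2 * (n : ℝ) ^ 2 * exp κ, ?_⟩⟩
  intro F₁ F₂ Λ₁ Λ₂ K₁ K₂ h₁ h₂ _ hF₁ hF₂
  have hA : ∀ a b : SUN N, dist (suEntries a) (suEntries b) ≤ 1 * suFrobDist a b := fun a b => by
    rw [one_mul]; exact dist_suEntries_le_suFrobDist a b
  have key := abs_covariance_le_of_starWindowBoundZdR hγ hD1 hloc hρ0 hρ1 h hμ'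
    hF₁.measurable hF₂.measurable hF₁.abs_le hF₂.abs_le hF₁.dependsOn hF₂.dependsOn
    (hF₁.isLipBound zero_le_one hA) (hF₂.isLipBound zero_le_one hA)
  have hK₁ : (0 : ℝ) ≤ K₁ := K₁.2
  have hK₂ : (0 : ℝ) ≤ K₂ := K₂.2
  have hn₁ : (Λ₁.card : ℝ) ≤ n := by exact_mod_cast h₁
  have hn₂ : (Λ₂.card : ℝ) ≤ n := by exact_mod_cast h₂
  have hsum₁ : ∑ y ∈ Λ₁, (if y ∈ Λ₁ then 1 * (K₁ : ℝ) else 0) ≤ n * K₁ := by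
    rw [Finset.sum_ite_of_true (fun y hy => hy), Finset.sum_const, nsmul_eq_mul, one_mul]
    exact mul_le_mul_of_nonneg_right hn₁ hK₁
  have hsum₂ : ∑ y ∈ Λ₂, (if y ∈ Λ₂ then 1 * (K₂ : ℝ) else 0) ≤ n * K₂ := by
    rw [Finset.sum_ite_of_true (fun y hy => hy), Finset.sum_const, nsmul_eq_mul, one_mul]
    exact mul_le_mul_of_nonneg_right hn₂ hK₂
  have hsum₁0 : 0 ≤ ∑ y ∈ Λ₁, (if y ∈ Λ₁ then 1 * (K₁ : ℝ) else 0) :=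
    Finset.sum_nonneg fun y hy => by rw [if_pos hy]; positivity
  -- `⌊dist/(D+2)⌋ ≥ dist/(D+2) − 1`
  have hgeom : exp (-(κ * ⌊setDistEdges Λ₁ Λ₂ / (D + 2 : ℕ)⌋₊)) ≤
      exp κ * exp (-(κ / (D + 2 : ℕ)) * setDistEdges Λ₁ Λ₂) := by
    rw [← exp_add]
    refine exp_le_exp.2 ?_
    have hfl : setDistEdges Λ₁ Λ₂ / (D + 2 : ℕ) - 1 ≤ (⌊setDistEdges Λ₁ Λ₂ / (D + 2 : ℕ)⌋₊ : ℝ) := by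
      have := Nat.lt_floor_add_one (setDistEdges Λ₁ Λ₂ / (D + 2 : ℕ))
      linarith
    have := mul_le_mul_of_nonneg_left hfl hκ0.le
    have e1 : -(κ / (D + 2 : ℕ)) * setDistEdges Λ₁ Λ₂ = -(κ * (setDistEdges Λ₁ Λ₂ / (D + 2 : ℕ))) := by
      field_simp
    rw [e1]
    linarith
  calc |cov[F₁, F₂; μ]|
      ≤ 4 * (2 * Real.sqrt N) ^ 2 * exp (-(κ * ⌊setDistEdges Λ₁ Λ₂ / (D + 2 : ℕ)⌋₊)) *
          (∑ y ∈ Λ₁, (if y ∈ Λ₁ then 1 * (K₁ : ℝ) else 0)) *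
          ∑ y ∈ Λ₂, (if y ∈ Λ₂ then 1 * (K₂ : ℝ) else 0) := key
    _ ≤ 4 * (2 * Real.sqrt N) ^ 2 * (exp κ * exp (-(κ / (D + 2 : ℕ)) * setDistEdges Λ₁ Λ₂)) *
          (n * K₁) * (n * K₂) := by
        gcongr
    _ = 4 * (2 * Real.sqrt N) ^ 2 * (n : ℝ) ^ 2 * exp κ * exp (-(κ / (D + 2 : ℕ)) * setDistEdges Λ₁ Λ₂) *
          ((K₁ : ℝ) * K₂) := by ring
    _ ≤ 4 * (2 * Real.sqrt N) ^ 2 * (n : ℝ) ^ 2 * exp κ * exp (-(κ / (D + 2 : ℕ)) * setDistEdges Λ₁ Λ₂) *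
          ((K₁ : ℝ) * K₂ + Real.sqrt (∫ U, F₁ U ^ 2 ∂μ) * Real.sqrt (∫ U, F₂ U ^ 2 ∂μ)) := by
        gcongr
        exact le_add_of_nonneg_right (by positivity)

end Summit.Ventures.YMGap.RobustBall

end
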